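import Summits.Ventures.LatticeQCDFlow.Scaling.StarSlowSwapLaw
import Summits.Ventures.LatticeQCDFlow.Scaling.DominatedStarRegimeFreeTimeAverages

/-!
HONEST FRAMING: exact (Metropolis-corrected) sampling algorithms for lattice gauge theory; figures
of merit are autocorrelation/cost numbers at stated couplings and volumes; no continuum-physics
claim.

# StarSlowSwapSampleSize — THE HONEST SAMPLE SIZE FOR THE HOMOGENEOUS `q`-CONTENT STAR AT SLOW SWAPS, FROM EVERY START:
# BURN-IN `r ≥ ⌈(12K(t+h)/(p·h·t))·log((eK/(p·W_lo)+1)/(ε/2))⌉`, RUN `N ≥ (4Var_π̃(f)/(η²ε))/(p·min{ct/(3m), h/(7K)})` ⇒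
# `P_x{|N⁻¹Σ_{s<N} f(X_{r+s}) − E_π̃ f| ≥ η} ≤ ε` — EVERY `q`, NOTHING OF `π̃_min` (lean-2 GEN-34, ours)

Venture-side (OURS).  Cell `lqcd-flow` (pub-lqcd), unit `pub-lqcd-lean-2-g34`, 2026-08-29.  Chapter U, file 6 — the practical form of `StarSlowSwapLaw`, assembled exactly as Q8
(`SectorExactSampleSize`): the slow-swap burn-in of chapter U (`homStar_worstTvDist_le_slowSwap`, `homStar_mixingTime_le_slowSwap'`) and chapter N's regime-free gap
`Gap ≥ p·min{ct/(3m), h/(7K)}` (`dominatedStar_spectralGap_ge_regimeFree`, one-sided domination `p·μ_1 ≤ μ_0` for identity maps) in Levin–Peres–Wilmer's Theorem 12.21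
(`Literature/Probability/MarkovChains/TimeAverageConcentration`, in the tree).

* **`homStar_slowSwap_timeAverage`** — homogeneous `q`-content star (`|S| ≥ 2`, persistent hub with exact redraws, `w_0 > 0`, `K ≥ 1` idle cold levels of one law, identity maps, uniform
  entry list with `c ≥ 1` entries per level, `0 < t < 1`), hub domination `p·μ_1 ≤ μ_0` (`0 < p`), `W_lo ≤ max{W(u),W(v)}` off the diagonal (`W = μ_1/μ_0`), `4t ≤ h`: from EVERY
  start `x`, with burn-in `r ≥ ⌈(12K(t+h)/(p·h·t))·log((eK/(pW_lo)+1)/(ε/2))⌉₊` and run length `N ≥ 1`, `N ≥ (4Var_π̃(f)/(η²ε))·(1/(p·min{ct/(3m), h/(7K)}))`, the time average of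
  any `f` deviates from `E_π̃ f` by `≥ η` with probability `≤ ε`.

Reading (no numerics implied): `O((K/(pt))·log(K/(pW_lo ε)))` steps of burn-in and `O(Var·max{m/(ct), K/h}/(p·η²ε))` steps of averaging, for every number of contents — the sample-size
recipe of the `q`-content star at slow swaps is law-free up to `p` and the logarithm of `W_lo`.  NOT CLAIMED: fast swaps; anything measured.  Literature grade (cell rule): OWN
COMPOSITION on U3, N2 and the typed [LevinPeres2017, Thm 12.21]; nothing new cited as a fact; no new bib keys.
-/

noncomputable section

open Finset Function Matrix
open Literature.Probability.MarkovChains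

namespace Summit.Ventures.LatticeQCDFlow.Scaling

variable {S : Type*} [Fintype S] [DecidableEq S] {K m : ℕ} {μ : Fin (K + 1) → S → ℝ} {M : Fin (K + 1) → S → S → ℝ}
  {w : Fin (K + 1) → ℝ} {t p : ℝ}

section SampleSize
variable (κ : Fin m → Fin K)

/-- **THE HONEST SAMPLE SIZE OF THE `q`-CONTENT STAR AT SLOW SWAPS, FROM EVERY START.** [ours] -/
theorem homStar_slowSwap_timeAverage [Nontrivial S] (hK : 1 ≤ K) (hm : 1 ≤ m) (ht0 : 0 < t) (ht1 : t < 1) (hw0 : ∀ k, 0 ≤ w k)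
    (hw00 : 0 < w 0) (hw1 : ∑ k, w k = 1) (hμ : ∀ k x, 0 < μ k x) (hμ1 : ∀ k, ∑ u, μ k u = 1) (hM0 : ∀ u v, M 0 u v = μ 0 v)
    (hidle : ∀ i : Fin K, ∀ u v, M i.succ u v = if v = u then 1 else 0) (hhom : ∀ i : Fin K, μ i.succ = μ 1)
    {c : ℕ} (hc1 : 1 ≤ c) (hunif : ∀ i : Fin K, (univ.filter fun r : Fin m => κ r = i).card = c)
    (hp0 : 0 < p) (hp : ∀ u, p * μ 1 u ≤ μ 0 u)
    {Wlo : ℝ} (hWlo0 : 0 < Wlo) (hWlo : ∀ u v, u ≠ v → Wlo ≤ max (μ 1 u / μ 0 u) (μ 1 v / μ 0 v))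
    (hslow : 4 * t ≤ (1 - t) * w 0)
    (f : (Fin (K + 1) → S) → ℝ) {ε η : ℝ} (hε : 0 < ε) (hη : 0 < η) {r N : ℕ}
    (hr : ⌈12 * K * (t + (1 - t) * w 0) / (p * ((1 - t) * w 0) * t) * Real.log ((Real.exp 1 * K / (p * Wlo) + 1) / (ε / 2))⌉₊ ≤ r) (hN : 0 < N)
    (hNvar : 4 * lawVariance (tensorFun μ) f / (η ^ 2 * ε) * (1 / (p * min (c * t / (3 * m)) ((1 - t) * w 0 / (7 * K)))) ≤ N)
    (x : Fin (K + 1) → S) :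
    pathSum (fun y z : Fin (K + 1) → S =>
        t * ptGraphSwap μ (fun r : Fin m => (((0 : Fin (K + 1)), (κ r).succ) : Fin (K + 1) × Fin (K + 1))) (fun _ : Fin m => Equiv.refl S) y z
          + (1 - t) * prodKernel w M y z) (N + r) x (fun ω =>
        if η ≤ |(∑ s : Fin N, f ((Matrix.vecCons x ω : Fin (N + r + 1) → (Fin (K + 1) → S))
              ⟨(s : ℕ) + r, by have := s.isLt; omega⟩)) / N - lawMean (tensorFun μ) f|
          then (1 : ℝ) else 0) ≤ ε := by
  have hmpos : (0 : ℝ) < m := Nat.cast_pos.mpr (by omega)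
  have hKpos : (0 : ℝ) < K := Nat.cast_pos.mpr (by omega)
  have hh0 : 0 < (1 - t) * w 0 := mul_pos (by linarith) hw00
  -- kernels: exact hot redraw and idle cold levels are row-stochastic and reversible
  have hM : ∀ k, IsRowStochastic (M k) := fun k => by
    cases k using Fin.cases with
    | zero => exact ⟨fun u v => by rw [hM0]; exact (hμ 0 v).le, fun u => by simp_rw [hM0]; exact hμ1 0⟩
    | succ i =>
      refine ⟨fun u v => by rw [hidle]; split_ifs <;> norm_num, fun u => ?_⟩
      simp_rw [hidle i]
      rw [Finset.sum_ite_eq' univ u, if_pos (mem_univ _)]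
  have hMrev : ∀ k, DetailedBalance (μ k) (M k) := fun k => by
    intro u v
    cases k using Fin.cases with
    | zero => rw [hM0, hM0, mul_comm]
    | succ i =>
      rw [hidle, hidle]
      by_cases huv : u = v
      · subst huv; rfl
      · rw [if_neg (Ne.symm huv), if_neg huv, mul_zero, mul_zero]
  have hp1 : p ≤ 1 := by
    have h := Finset.sum_le_sum fun u (_ : u ∈ (univ : Finset S)) => hp u
    rw [← Finset.mul_sum, hμ1 1, hμ1 0, mul_one] at h; exact h
  have hdom : ∀ (r : Fin m) (u : S), p * μ (κ r).succ ((fun _ : Fin m => Equiv.refl S) r u) ≤ μ 0 u := fun r u => by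
    simp only [Equiv.refl_apply]; rw [hhom]; exact hp u
  have hc : ∀ p' : Fin K, c ≤ (univ.filter (fun r : Fin m => κ r = p')).card := fun p' => (hunif p').ge
  have hP := weightedScheme_isRowStochastic (t := t) (w := w)
    (ptGraphSwap_isRowStochastic (e := fun r : Fin m => (((0 : Fin (K + 1)), (κ r).succ) : Fin (K + 1) × Fin (K + 1)))
      (φ := fun _ : Fin m => Equiv.refl S) hμ) hM hw0 hw1 ht0.le ht1.le
  have hDB := weightedScheme_detailedBalance (w := w)
    (ptGraphSwap_detailedBalance (e := fun r : Fin m => (((0 : Fin (K + 1)), (κ r).succ) : Fin (K + 1) × Fin (K + 1)))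
      (φ := fun _ : Fin m => Equiv.refl S) hμ) hMrev t
  have hirr := dominatedStar_isIrreducible_regimeFree κ (fun _ : Fin m => Equiv.refl S) ht0 ht1 hw0 hw00 hw1 hμ hM hM0 hc1 hc
  have hε2 : 0 < ε / 2 := by linarith
  -- the burn-in of chapter U
  set r₀ : ℕ := ⌈12 * K * (t + (1 - t) * w 0) / (p * ((1 - t) * w 0) * t) * Real.log ((Real.exp 1 * K / (p * Wlo) + 1) / (ε / 2))⌉₊ with hr₀
  have hmix := homStar_mixingTime_le_slowSwap' κ hm ht0 ht1 hw0 hw00 hw1 hμ hμ1 hM0 hidle hhom hunif hp0 hp hWlo0 hWlo hslow hε2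
  have ht₀ : worstTvDist (fun y z : Fin (K + 1) → S =>
      t * ptGraphSwap μ (fun r : Fin m => (((0 : Fin (K + 1)), (κ r).succ) : Fin (K + 1) × Fin (K + 1))) (fun _ : Fin m => Equiv.refl S) y z
        + (1 - t) * prodKernel w M y z) (tensorFun μ) r₀ ≤ ε / 2 := by
    have hmK : (m : ℝ) = c * K := uniformList_card κ hunif
    have hth : (0 : ℝ) < t + (1 - t) * w 0 := by linarith
    set a := (1 - t) * w 0 * (t / (t + (1 - t) * w 0) * (p / 3) / K) / 4 with ha
    have ha0 : 0 < a := by positivity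
    have hC : 0 < Real.exp 1 * (K * (1 / (p * Wlo))) + 1 := by positivity
    have e1 : 1 / a = 12 * K * (t + (1 - t) * w 0) / (p * ((1 - t) * w 0) * t) := by
      rw [ha]; field_simp; ring
    have e2 : Real.exp 1 * (K * (1 / (p * Wlo))) + 1 = Real.exp 1 * K / (p * Wlo) + 1 := by field_simp
    have hn : 1 / a * Real.log ((Real.exp 1 * (K * (1 / (p * Wlo))) + 1) / (ε / 2)) ≤ r₀ := by
      rw [e1, e2]; exact Nat.le_ceil _
    have h := homStar_worstTvDist_le_slowSwap κ hm ht0 ht1 hw0 hw00 hw1 hμ hμ1 hM0 hidle hhom hunif hp0 hp hWlo0 hWlo hslow r₀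
    rw [← ha] at h
    exact h.trans (exp_le_of_ge_log ha0 hC hε2 hn)
  -- the run length through `Gap ≥ p·min{ct/(3m), (1−t)w_0/(7K)}`
  have hgap := dominatedStar_spectralGap_ge_regimeFree κ (fun _ : Fin m => Equiv.refl S) hK hm ht0 ht1 hw0 hw00 hw1 hμ hμ1 hM hMrev hM0 hp0 hp1 hdom hc1 hc
  have hGpos : 0 < p * min (c * t / (3 * m)) ((1 - t) * w 0 / (7 * K)) := mul_pos hp0 (lt_min (by positivity) (by positivity))
  have hγinv : (spectralGap (tensorFun μ) (fun y z : Fin (K + 1) → S =>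
      t * ptGraphSwap μ (fun r : Fin m => (((0 : Fin (K + 1)), (κ r).succ) : Fin (K + 1) × Fin (K + 1))) (fun _ : Fin m => Equiv.refl S) y z
        + (1 - t) * prodKernel w M y z))⁻¹ ≤ 1 / (p * min (c * t / (3 * m)) ((1 - t) * w 0 / (7 * K))) := by
    rw [← one_div]; exact one_div_le_one_div_of_le hGpos hgap
  have hV : 0 ≤ 4 * lawVariance (tensorFun μ) f / (η ^ 2 * ε) :=
    div_nonneg (mul_nonneg (by norm_num) (lawVariance_nonneg (fun z => (tensorFun_pos hμ z).le) f)) (by positivity)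
  exact LevinPeres2017_thm_12_21 (fun z => tensorFun_pos hμ z) (sum_tensorFun_eq_one _ hμ1) hP hDB hirr f hε hη ht₀ (hmix.trans hr) hN
    ((mul_le_mul_of_nonneg_left hγinv hV).trans hNvar) x

end SampleSize

end Summit.Ventures.LatticeQCDFlow.Scaling

end
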